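import Summits.QuantumFields.YangMills.Theorems.UnitScaleTiltProp7CombGaugeIter
import Summits.QuantumFields.YangMills.Theorems.UnitScaleTiltProp7CombMeanCentred
import Literature.MathematicalPhysics.QuantumFieldTheory.Balaban1983to89.B5Positivity172Lattice
import HarnessLib

/-!
# BalabanUVNodes ∕ N12 — (β)♭: THE NULL SPACE OF THE FLAT SECOND VARIATION ON THE LINEARISED (0.4)-FIBRE IS THE LIE ALGEBRA OF PRINT'S GROUP (4)
# (the infinitesimal gauge transformations vanishing at the k-fold block centres); hence the nondegeneracy letter `hnd` at the flat configuration holds on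
# EVERY gauge slice transversal to those — [Balaban1985Variational] Sect. A (4)∕(6) p. 278, Sect. E p. 300; [Balaban1989LargeFieldII] p. 359 «By the
# inequality (1.9) the operator P₀H*_{1,k}Δ₁H_{1,k}P₀ is positive, hence invertible on this subspace», READ AT THE FLAT CONFIGURATION, QUALITATIVELY

Cell `pub-ymgap` (HUMAN RULINGS D-0062 ∕ D-0149), WIDTH SEAT `pub-ymgap-dag-n12-w3` g2 (node N12 = [B15]; key K1⁷ `stmt-QuantumFields-20542`,
`--kind proof --supports … --as helper`; count-neutral).  THEOREMS ONLY (0 `def`, 0 `instance`, 0 `sorry`); every input CONSUMED BY NAME, nothing modified: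
the route UnitScaleTilt's library of the linearised (0.4)-average (`Prop7CombGauge.iterLin_add`, `Prop7AvgLinearisation.iterLin_grad` ∕ `linAvg_nsmul`,
`Prop7CombMeanCentred.combMean_dirConst`, `BlockAveragingEMLLinearised.linAvg_eq_bondAvg_sub_grad_combMean`), the V1 torus Poincaré lemma
`B5Positivity172Lattice.exists_grad_add_dirConst_of_curl_eq_zero` ([Balaban1984PropagatorsI] p. 30) and the charted-torus cochain calculus `TorusChart.d₀_eq_zero_iff`.

THE PRINT.  [Balaban1985Variational] p. 278: the variational problem (5)–(6) is posed modulo the group (4) of gauge transformations `u` with `u(y) = 1` at the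
points `y` of the `k`-lattice (the block centres), and Sect. E p. 300 proves the Hessian of the Wilson action on the constrained space is positive on the
axial-gauge subspace; [Balaban1989LargeFieldII] p. 359 uses exactly this positivity («P₀H*Δ₁HP₀ … invertible») to solve for the minimiser family of
[Balaban1989LargeFieldI] Prop. 1.  At the FLAT configuration `U₀ = 1` the second variation of `A ∘ expChart 1` is `(1∕N)·Σ_p ‖X⟨s,μ⟩ + X⟨s+e_μ,ν⟩ − X⟨s+e_ν,μ⟩ − X⟨s,ν⟩‖²`
(`Node00.deriv_deriv_wilsonAction4_expChart_one_eq_norm_sq`, dag-n12-w2) and the linearised multi-scale (0.4)-constraint is the `linAvg`-recursion `Q^{(·)}`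
(`N12FlatChartDerivIterLin.fderiv_msChart_one_apply_eq_iterLin`, dag-n10-w1).  This file identifies the directions on the linearised fibre `ker Q^{(k)}` along which
that second variation vanishes.

CONTENTS.
§1 `bondAvg_dirConst_vec` ((1.57) «Q_kA₀ = A₀» for a `Module ℝ V`-valued constant vector function), `linAvg_dirConst` (the linearised (0.4) average of a
   direction-constant field is `L·` it: main term `L·Q` by §5 of `BlockAveragingEMLLinearised`, the comb-mean gradient vanishes by `combMean_dirConst`),
   ★ `iterLin_dirConst` (`Q^{(k)}A₀ = L^k·A₀`).
§2 `const_of_shift_eq` (a shift-invariant function on the sites of `T^{(j)}` with values in any additive group is constant — `TorusChart.d₀_eq_zero_iff`),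
   `mem_of_sub_mem` (a site function whose bond differences lie in a subgroup `M` and which meets `M` at one site is `M`-valued),
   `sum_shift_eq` (re-indexing a site sum by `x ↦ x + e_μ`), ★★ `exists_grad_add_dirConst_of_plaq_eq_zero_matrix` (the torus Poincaré lemma for
   MATRIX-valued bond fields: curl-free ⇒ gradient plus a constant vector function; entrywise from the V1 lemma, real and imaginary parts).
§3 ★★★ `exists_centreGauge_of_plaq_eq_zero_of_iterLin_eq_zero`: `∂X = 0 ∧ Q^{(k)}X = 0` on all level-`k` bonds ⟹ `X = dφ` with `φ = 0` at every k-fold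
   centre `embIter k y`; ★★★ `plaq_eq_zero_and_iterLin_eq_zero_iff` (the converse by `iterLin_grad`): THE NULL SPACE IS EXACTLY `Lie (4)`.
§4 ★★ `eq_zero_of_transversal_of_iterLin_eq_zero` — the `hnd` SHAPE: on any set `S` of fine fields transversal to the centre-vanishing pure gauges
   (DISPLAYED letter `hS`; print: the block-axial gauge, where it is telescoping), `X ∈ S ∧ Q^{(k)}X = 0 ∧ ∂X = 0 ⟹ X = 0`;
   `centreGauge_mem` (if `X` takes values in an additive subgroup — e.g. `𝔰𝔲(N)` — so does the gauge function `φ` of §3).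

HONEST FRAMING.  Lattice linear algebra at the FLAT configuration only (`U₀ = 1`, where the Lagrange multiplier vanishes and the Lagrangian Hessian is the
bare second variation); the constraint is imposed on ALL level-`k` bonds (the determining set `atScale k`); the slice letter of §4 is DISPLAYED, not chosen
here; NO coercivity constant is produced (that is `B5Prop11FlatSliceCurlCoercivity` ∕ `Prop7FlatHodgeCoercivity` on the Landau slice, and the comparison
with the record's axial slice remains); the near-flat backgrounds `U₀ ≠ 1` of the minimiser family are NOT treated.  Nothing of Bałaban's estimates is
asserted; N12 NOT discharged; K1⁷ NOT closed; counts unmoved (typed 28∕28 · discharged 5∕27); one finite 𝕋⁴ programme at fixed ε — R4 closes the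
conditional rung `BalabanLadder.UV` only; the Yang–Mills mass gap (Clay) is NOT proved by any of this; nothing continuum ∕ ℝ⁴ ∕ OS.
-/

noncomputable section

open scoped BigOperators Matrix

namespace Summit.QuantumFields.YangMills.BalabanUVNodes.N12FlatFibreNullSpace

open Literature.MathematicalPhysics.QuantumFieldTheory (TorusChart)
open Literature.MathematicalPhysics.QuantumFieldTheory.Balaban1983to89
open T4Continuum AveragingRT BlockAveraging BlockAveragingEMLLinearised LatticeFieldCalculus
open B15DeterminingSets (embIter)
open B5Positivity172Lattice (TT chart toT ofT shift_eq dirConst dirConst_apply exists_grad_add_dirConst_of_curl_eq_zero)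
open Summit.QuantumFields.YangMills.Theorems.Prop7CombGauge (iterLin_add)
open Summit.QuantumFields.YangMills.Theorems.Prop7AvgLinearisation (iterLin_grad linAvg_nsmul)
open Summit.QuantumFields.YangMills.Theorems.Prop7CombMeanCentred (combMean_dirConst)

variable {P : Params}

/-! ## §1 The linearised (0.4) average of a constant vector function -/

section DirConst

variable {j : ℕ}

/-- **(1.57) «Q_kA₀ = A₀» for vector-valued constants**: the straight-line block average of the bond field `b ↦ c_{dir b}` (one constant per direction,
with values in any real vector space) is the same field on the coarse lattice — `L^{−(d+1)}·L^d·L·c_μ = c_μ` (the `Module ℝ V` twin of the V1 lemma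
`B5Positivity172Lattice.bondAvg_dirConst`). [cite: Balaban1984PropagatorsI, (1.57) p.27] -/
theorem bondAvg_dirConst_vec {V : Type*} [AddCommGroup V] [Module ℝ V] (c : Fin P.d → V) :
    bondAvg (fun b : PBond P j => c b.dir) = fun b : PBond P (j + 1) => c b.dir := by
  funext b
  have hL : (P.L : ℝ) ≠ 0 := Nat.cast_ne_zero.mpr P.L_pos.ne'
  simp only [bondAvg, segSum, runBond, Finset.sum_const, Finset.card_range, Finset.card_univ, Fintype.card_fun, Fintype.card_fin,
    smul_smul, ← Nat.cast_smul_eq_nsmul ℝ]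
  rw [show ((P.L : ℝ) ^ (P.d + 1))⁻¹ * (((P.L ^ P.d : ℕ) : ℝ) * (P.L : ℝ)) = 1 by
    push_cast; rw [← pow_succ]; field_simp]
  exact one_smul _ _

variable {n : Type*} [Fintype n] [DecidableEq n]

omit [Fintype n] [DecidableEq n] in
/-- **THE LINEARISED (0.4) AVERAGE OF A CONSTANT VECTOR FUNCTION IS `L` TIMES IT**: `Q₁(b ↦ c_{dir b})(c′) = L·c_{dir c′}` — by §5 of
`BlockAveragingEMLLinearised` the linearised average is `L·Q` minus the coarse gradient of the comb mean, `Q` reproduces constants (§1) and the comb mean of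
a direction-constant field vanishes on centred blocks (`Prop7CombMeanCentred.combMean_dirConst`). [cite: Balaban1985Averaging, (124)-(125) p.36] -/
theorem linAvg_dirConst (c : Fin P.d → Matrix n n ℂ) (b : PBond P (j + 1)) :
    linAvg (fun e : PBond P j => c e.dir) b = (P.L : ℕ) • c b.dir := by
  rw [linAvg_eq_bondAvg_sub_grad_combMean, combMean_dirConst, combMean_dirConst, sub_self, sub_zero, bondAvg_dirConst_vec,
    Nat.cast_smul_eq_nsmul]

omit [Fintype n] [DecidableEq n] in
/-- ★ **`Q^{(k)}A₀ = L^k·A₀`**: every recursion family of the linearised (0.4) average (`Q^{(0)} = id`, `Q^{(i+1)} = Q₁ ∘ Q^{(i)}`) multiplies a constant vector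
function by `L` per step. [cite: Balaban1984PropagatorsI, (1.57) p.27; Balaban1985Averaging, (124)-(125) p.36] -/
theorem iterLin_dirConst (Q : (i : ℕ) → (PBond P 0 → Matrix n n ℂ) → PBond P i → Matrix n n ℂ)
    (hQ0 : ∀ Y, Q 0 Y = Y) (hQs : ∀ (i : ℕ) (Y : PBond P 0 → Matrix n n ℂ) (c : PBond P (i + 1)), Q (i + 1) Y c = linAvg (Q i Y) c)
    (c : Fin P.d → Matrix n n ℂ) : ∀ (k : ℕ) (b : PBond P k), Q k (fun e => c e.dir) b = (P.L ^ k : ℕ) • c b.dir := by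
  intro k
  induction k with
  | zero => intro b; rw [hQ0, pow_zero, one_smul]
  | succ k ih =>
    intro b
    rw [hQs, show Q k (fun e => c e.dir) = fun e : PBond P k => (P.L ^ k : ℕ) • c e.dir from funext ih, linAvg_nsmul,
      linAvg_dirConst, smul_smul, pow_succ]

end DirConst

/-! ## §2 Lattice letters: constancy, membership along bonds, re-indexing, and the matrix-valued torus Poincaré lemma -/

section Lattice

variable {j : ℕ}

/-- **A SHIFT-INVARIANT SITE FUNCTION IS CONSTANT** (the torus `T^{(j)}` is connected by unit translations): if `ψ(x + e_μ) = ψ(x)` for all `x, μ` then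
`ψ(x) = ψ(0)` — `TorusChart.d₀_eq_zero_iff` on the isotropic chart of `B5Positivity172Lattice`, for values in any additive group. [folklore] -/
theorem const_of_shift_eq {V : Type*} [AddCommGroup V] (ψ : Site P j → V) (h : ∀ (x : Site P j) (μ : Fin P.d), ψ (x.shift μ) = ψ x)
    (x : Site P j) : ψ x = ψ (ofT (0 : TT P j)) := by
  have hd : (chart P j).d₀ (fun z => ψ (ofT z)) = 0 := by
    funext z μ
    rw [TorusChart.d₀_apply, Pi.zero_apply, Pi.zero_apply]
    have hz := h (ofT z) μ
    rw [shift_eq] at hz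
    rw [sub_eq_zero]
    exact hz
  exact ((chart P j).d₀_eq_zero_iff _).mp hd (toT x)

/-- **MEMBERSHIP PROPAGATES ALONG BONDS**: if every bond difference `φ(b₊) − φ(b₋)` lies in an additive subgroup `M` and `φ(x₀) ∈ M` at one site, then `φ` is
`M`-valued (constancy of `φ` modulo `M`). [folklore] -/
theorem mem_of_sub_mem {V : Type*} [AddCommGroup V] (M : AddSubgroup V) (φ : Site P j → V)
    (hφ : ∀ b : PBond P j, φ b.tgt - φ b.src ∈ M) {x₀ : Site P j} (hx₀ : φ x₀ ∈ M) (x : Site P j) : φ x ∈ M := by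
  have hconst := const_of_shift_eq (fun z => (QuotientAddGroup.mk (φ z) : V ⧸ M)) (fun z μ => by
    rw [QuotientAddGroup.eq_iff_sub_mem]
    exact hφ ⟨z, μ⟩)
  have h0 : (QuotientAddGroup.mk (φ (ofT (0 : TT P j))) : V ⧸ M) = 0 := by
    rw [← hconst x₀, QuotientAddGroup.eq_zero_iff]
    exact hx₀
  have hx := hconst x
  rw [h0, QuotientAddGroup.eq_zero_iff] at hx
  exact hx

/-- Re-indexing a site sum by the unit translation `x ↦ x + e_μ` (a permutation of the finite torus, `LatticeFieldCalculus.shiftEquiv`). [folklore] -/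
theorem sum_shift_eq {V : Type*} [AddCommMonoid V] (μ : Fin P.d) (F : Site P j → V) :
    ∑ x : Site P j, F (x.shift μ) = ∑ x : Site P j, F x :=
  Fintype.sum_equiv (shiftEquiv μ) (fun x => F (x.shift μ)) F fun _ => rfl

variable {n : Type*}

/-- The `(a,b)` entry, real part, of the plaquette combination is the plaquette combination of the real `(a,b)` entries (`curl 1`, lattice factor `1`). [folklore] -/
private theorem re_curl_apply (X : PBond P j → Matrix n n ℂ) (p : Plaq P j) (a b : n) :
    ((curl 1 X p) a b).re = curl 1 (fun e : PBond P j => ((X e) a b).re) p := by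
  simp only [curl, one_smul, Matrix.add_apply, Matrix.sub_apply, Complex.add_re, Complex.sub_re]

/-- Imaginary-part version of `re_curl_apply`. [folklore] -/
private theorem im_curl_apply (X : PBond P j → Matrix n n ℂ) (p : Plaq P j) (a b : n) :
    ((curl 1 X p) a b).im = curl 1 (fun e : PBond P j => ((X e) a b).im) p := by
  simp only [curl, one_smul, Matrix.add_apply, Matrix.sub_apply, Complex.add_im, Complex.sub_im]

/-- ★★ **THE TORUS POINCARÉ LEMMA FOR MATRIX-VALUED BOND FIELDS** ([Balaban1984PropagatorsI] p. 30 «A = ∂(…) + A₀ where A₀ is a constant vector function»):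
a bond field on `T^{(j)}` all of whose plaquette variables vanish is a gradient plus a constant vector function — entrywise (real and imaginary parts) from
the V1 lemma `B5Positivity172Lattice.exists_grad_add_dirConst_of_curl_eq_zero`. [cite: Balaban1984PropagatorsI, (1.72) p.30] -/
theorem exists_grad_add_dirConst_of_plaq_eq_zero_matrix (X : PBond P j → Matrix n n ℂ)
    (hcurl : ∀ p : Plaq P j, X ⟨p.src, p.μ⟩ + X ⟨p.src.shift p.μ, p.ν⟩ - X ⟨p.src.shift p.ν, p.μ⟩ - X ⟨p.src, p.ν⟩ = 0) :
    ∃ (φ : Site P j → Matrix n n ℂ) (A : Fin P.d → Matrix n n ℂ), ∀ e : PBond P j, X e = (φ e.tgt - φ e.src) + A e.dir := by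
  classical
  have hc : ∀ p : Plaq P j, curl 1 X p = 0 := fun p => by rw [curl, one_smul]; exact hcurl p
  have Hre : ∀ a b : n, ∃ (φ : SiteField P j ℝ) (c : Fin P.d → ℝ),
      (fun e : PBond P j => ((X e) a b).re) = grad 1 φ + dirConst c := fun a b =>
    exists_grad_add_dirConst_of_curl_eq_zero one_ne_zero (funext fun p => by rw [← re_curl_apply, hc p]; rfl)
  have Him : ∀ a b : n, ∃ (φ : SiteField P j ℝ) (c : Fin P.d → ℝ),
      (fun e : PBond P j => ((X e) a b).im) = grad 1 φ + dirConst c := fun a b =>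
    exists_grad_add_dirConst_of_curl_eq_zero one_ne_zero (funext fun p => by rw [← im_curl_apply, hc p]; rfl)
  choose φr cr hr using Hre
  choose φi ci hi using Him
  refine ⟨fun x => Matrix.of fun a b => (⟨φr a b x, φi a b x⟩ : ℂ), fun μ => Matrix.of fun a b => (⟨cr a b μ, ci a b μ⟩ : ℂ), fun e => ?_⟩
  refine Matrix.ext fun a b => Complex.ext ?_ ?_
  · have h := congrFun (hr a b) e
    simp only [Pi.add_apply, grad, one_smul, dirConst_apply] at h
    simp only [Matrix.add_apply, Matrix.sub_apply, Matrix.of_apply, Complex.add_re, Complex.sub_re]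
    exact h
  · have h := congrFun (hi a b) e
    simp only [Pi.add_apply, grad, one_smul, dirConst_apply] at h
    simp only [Matrix.add_apply, Matrix.sub_apply, Matrix.of_apply, Complex.add_im, Complex.sub_im]
    exact h

end Lattice

/-! ## §3 The null space of the flat second variation on the linearised fibre -/

section NullSpace

variable {n : Type*} [Fintype n] [DecidableEq n]

omit [Fintype n] [DecidableEq n] in
/-- ★★★ **`∂X = 0 ∧ Q^{(k)}X = 0 ⟹ X = dφ` WITH `φ` VANISHING AT THE k-FOLD CENTRES.**  For every recursion family `Q^{(·)}` of the linearised (0.4) average and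
every fine matrix-valued bond field `X` on `T^{(0)}` whose plaquette variables all vanish (the null directions of the flat second variation
`(1∕N)·Σ_p‖X⟨s,μ⟩ + X⟨s+e_μ,ν⟩ − X⟨s+e_ν,μ⟩ − X⟨s,ν⟩‖²`) and whose `k`-fold linearised average vanishes on every level-`k` bond (the linearised fibre of the
flat datum), there is a site function `φ` with `φ(embIter k y) = 0` for all `y ∈ T^{(k)}` and `X(b) = φ(b₊) − φ(b₋)` — an infinitesimal gauge transformation
of print's group (4).  ROUTE: `X = dφ₀ + A₀` (§2 Poincaré); `Q^{(k)}X = d(φ₀∘embIter k) + L^k·A₀` (`iterLin_add`, `iterLin_grad`, §1); summing the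
`μ`-bonds of `T^{(k)}` kills `A₀`; then `φ₀∘embIter k` is shift-invariant, hence a constant, which is subtracted.
[cite: Balaban1985Variational, (4) p.278, Sect. E p.300; Balaban1984PropagatorsI, (1.72) p.30; Balaban1985Averaging, (11) p.18] -/
theorem exists_centreGauge_of_plaq_eq_zero_of_iterLin_eq_zero
    (Q : (i : ℕ) → (PBond P 0 → Matrix n n ℂ) → PBond P i → Matrix n n ℂ)
    (hQ0 : ∀ Y, Q 0 Y = Y) (hQs : ∀ (i : ℕ) (Y : PBond P 0 → Matrix n n ℂ) (c : PBond P (i + 1)), Q (i + 1) Y c = linAvg (Q i Y) c)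
    (k : ℕ) (X : PBond P 0 → Matrix n n ℂ)
    (hcurl : ∀ p : Plaq P 0, X ⟨p.src, p.μ⟩ + X ⟨p.src.shift p.μ, p.ν⟩ - X ⟨p.src.shift p.ν, p.μ⟩ - X ⟨p.src, p.ν⟩ = 0)
    (hQ : ∀ c : PBond P k, Q k X c = 0) :
    ∃ φ : Site P 0 → Matrix n n ℂ, (∀ y : Site P k, φ (embIter k y) = 0) ∧ ∀ b : PBond P 0, X b = φ b.tgt - φ b.src := by
  obtain ⟨φ₀, A, hX⟩ := exists_grad_add_dirConst_of_plaq_eq_zero_matrix X hcurl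
  have hXf : X = fun b : PBond P 0 => (φ₀ b.tgt - φ₀ b.src) + A b.dir := funext hX
  -- `Q^{(k)}X = d(φ₀∘embIter k) + L^k·A₀ = 0` on every level-`k` bond
  have hk : ∀ c : PBond P k, φ₀ (embIter k c.tgt) - φ₀ (embIter k c.src) + (P.L ^ k : ℕ) • A c.dir = 0 := fun c => by
    have h := hQ c
    rw [hXf, iterLin_add Q hQ0 hQs (fun b : PBond P 0 => φ₀ b.tgt - φ₀ b.src) (fun b => A b.dir) k c,
      iterLin_grad Q hQ0 hQs (fun i φ y => φ (embIter i y)) (fun φ => rfl) (fun i φ y => rfl) φ₀ k c,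
      iterLin_dirConst Q hQ0 hQs A k c] at h
    exact h
  -- summing the `μ`-bonds kills the constant vector function
  have hA : ∀ μ : Fin P.d, A μ = 0 := fun μ => by
    have hsum : ∑ y : Site P k, (φ₀ (embIter k ((⟨y, μ⟩ : PBond P k).tgt)) - φ₀ (embIter k y) + (P.L ^ k : ℕ) • A μ) = 0 :=
      Finset.sum_eq_zero fun y _ => hk ⟨y, μ⟩
    rw [Finset.sum_add_distrib, Finset.sum_sub_distrib] at hsum
    have htgt : ∑ y : Site P k, φ₀ (embIter k ((⟨y, μ⟩ : PBond P k).tgt)) = ∑ y : Site P k, φ₀ (embIter k y) :=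
      sum_shift_eq μ (fun y => φ₀ (embIter k y))
    rw [htgt, sub_self, zero_add, Finset.sum_const, Finset.card_univ, smul_smul, ← Nat.cast_smul_eq_nsmul ℂ, smul_eq_zero] at hsum
    refine hsum.resolve_left (Nat.cast_ne_zero.mpr (mul_ne_zero Fintype.card_ne_zero (pow_ne_zero _ P.L_pos.ne')))
  -- hence `φ₀∘embIter k` is shift-invariant, i.e. constant
  have hshift : ∀ (y : Site P k) (μ : Fin P.d), φ₀ (embIter k (y.shift μ)) = φ₀ (embIter k y) := fun y μ => by
    have h := hk ⟨y, μ⟩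
    rw [hA, smul_zero, add_zero, sub_eq_zero] at h
    exact h
  refine ⟨fun x => φ₀ x - φ₀ (embIter k (ofT (0 : TT P k))), fun y => ?_, fun b => ?_⟩
  · rw [sub_eq_zero]
    exact const_of_shift_eq (fun y => φ₀ (embIter k y)) hshift y
  · rw [hX b, hA, add_zero, sub_sub_sub_cancel_right]

omit [Fintype n] [DecidableEq n] in
/-- ★★★ **THE NULL SPACE OF THE FLAT SECOND VARIATION ON THE LINEARISED (0.4)-FIBRE IS EXACTLY `Lie (4)`**: for a fine matrix-valued bond field `X`,
«all plaquette variables vanish and the `k`-fold linearised average vanishes on every level-`k` bond» IFF «`X = dφ` for a site function `φ` vanishing at the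
`k`-fold centres» (⇐: a gradient is curl-free, and `Q^{(k)}(dφ) = d(φ∘embIter k) = 0`, `Prop7AvgLinearisation.iterLin_grad`).
[cite: Balaban1985Variational, (4) p.278, Sect. E p.300; Balaban1989LargeFieldII, (1.9) p.358, p.359] -/
theorem plaq_eq_zero_and_iterLin_eq_zero_iff
    (Q : (i : ℕ) → (PBond P 0 → Matrix n n ℂ) → PBond P i → Matrix n n ℂ)
    (hQ0 : ∀ Y, Q 0 Y = Y) (hQs : ∀ (i : ℕ) (Y : PBond P 0 → Matrix n n ℂ) (c : PBond P (i + 1)), Q (i + 1) Y c = linAvg (Q i Y) c)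
    (k : ℕ) (X : PBond P 0 → Matrix n n ℂ) :
    ((∀ p : Plaq P 0, X ⟨p.src, p.μ⟩ + X ⟨p.src.shift p.μ, p.ν⟩ - X ⟨p.src.shift p.ν, p.μ⟩ - X ⟨p.src, p.ν⟩ = 0) ∧
        ∀ c : PBond P k, Q k X c = 0) ↔
      ∃ φ : Site P 0 → Matrix n n ℂ, (∀ y : Site P k, φ (embIter k y) = 0) ∧ ∀ b : PBond P 0, X b = φ b.tgt - φ b.src := by
  constructor
  · rintro ⟨hcurl, hQ⟩
    exact exists_centreGauge_of_plaq_eq_zero_of_iterLin_eq_zero Q hQ0 hQs k X hcurl hQ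
  · rintro ⟨φ, hφ, hX⟩
    have hXf : X = fun b : PBond P 0 => φ b.tgt - φ b.src := funext hX
    refine ⟨fun p => ?_, fun c => ?_⟩
    · have h := curl_grad (1 : ℝ) 1 φ p
      simp only [curl, grad, one_smul] at h
      rw [hX, hX, hX, hX]
      exact h
    · rw [hXf, iterLin_grad Q hQ0 hQs (fun i φ y => φ (embIter i y)) (fun φ => rfl) (fun i φ y => rfl) φ k c, hφ, hφ, sub_self]

end NullSpace

/-! ## §4 The `hnd` shape on a transversal slice; values in a subgroup -/

section Slice

variable {n : Type*} [Fintype n] [DecidableEq n]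

omit [Fintype n] [DecidableEq n] in
/-- ★★ **THE NONDEGENERACY LETTER AT THE FLAT CONFIGURATION, MODULO THE SLICE LETTER** ([LF-II] p. 359 «P₀H*Δ₁HP₀ is positive, hence invertible on this
subspace», qualitatively, at `U₀ = 1`): if a set `S` of fine fields is TRANSVERSAL to the centre-vanishing pure gauges (`hS`: the only `dφ ∈ S` with
`φ|_{centres} = 0` is `0` — for print's block-axial gauge this is telescoping along the combs), then every `X ∈ S` on the linearised fibre (`Q^{(k)}X = 0` on all
level-`k` bonds) along which the flat second variation vanishes (all plaquette variables of `X` vanish) is `X = 0`.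
[cite: Balaban1989LargeFieldII, (1.9) p.358, p.359; Balaban1985Variational, Sect. E p.300] -/
theorem eq_zero_of_transversal_of_iterLin_eq_zero
    (Q : (i : ℕ) → (PBond P 0 → Matrix n n ℂ) → PBond P i → Matrix n n ℂ)
    (hQ0 : ∀ Y, Q 0 Y = Y) (hQs : ∀ (i : ℕ) (Y : PBond P 0 → Matrix n n ℂ) (c : PBond P (i + 1)), Q (i + 1) Y c = linAvg (Q i Y) c)
    (k : ℕ) {S : Set (PBond P 0 → Matrix n n ℂ)}
    (hS : ∀ φ : Site P 0 → Matrix n n ℂ, (∀ y : Site P k, φ (embIter k y) = 0) →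
      (fun b : PBond P 0 => φ b.tgt - φ b.src) ∈ S → ∀ b : PBond P 0, φ b.tgt - φ b.src = 0)
    {X : PBond P 0 → Matrix n n ℂ} (hXS : X ∈ S)
    (hcurl : ∀ p : Plaq P 0, X ⟨p.src, p.μ⟩ + X ⟨p.src.shift p.μ, p.ν⟩ - X ⟨p.src.shift p.ν, p.μ⟩ - X ⟨p.src, p.ν⟩ = 0)
    (hQ : ∀ c : PBond P k, Q k X c = 0) : X = 0 := by
  obtain ⟨φ, hφ, hX⟩ := exists_centreGauge_of_plaq_eq_zero_of_iterLin_eq_zero Q hQ0 hQs k X hcurl hQ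
  have hXf : X = fun b : PBond P 0 => φ b.tgt - φ b.src := funext hX
  funext b
  rw [hX b, Pi.zero_apply]
  exact hS φ hφ (hXf ▸ hXS) b

omit [Fintype n] [DecidableEq n] in
/-- **THE GAUGE FUNCTION INHERITS THE VALUE SUBGROUP**: if `X` takes values in an additive subgroup `M` of the matrices (e.g. `𝔰𝔲(N)`) and `X = dφ` with `φ`
vanishing at the `k`-fold centres, then `φ` is `M`-valued (membership propagates along bonds from a centre, §2). [folklore] -/
theorem centreGauge_mem (M : AddSubgroup (Matrix n n ℂ)) {k : ℕ} {X : PBond P 0 → Matrix n n ℂ} (hXM : ∀ b, X b ∈ M)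
    {φ : Site P 0 → Matrix n n ℂ} (hφ : ∀ y : Site P k, φ (embIter k y) = 0) (hX : ∀ b : PBond P 0, X b = φ b.tgt - φ b.src)
    (x : Site P 0) : φ x ∈ M :=
  mem_of_sub_mem M φ (fun b => hX b ▸ hXM b) (x₀ := embIter k default) (by rw [hφ]; exact M.zero_mem) x

end Slice

end Summit.QuantumFields.YangMills.BalabanUVNodes.N12FlatFibreNullSpace

end
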